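import Literature.MathematicalPhysics.QuantumFieldTheory.Balaban1983to89.B6KLevelFamilyWitnessOddLV1
import Literature.MathematicalPhysics.QuantumFieldTheory.Balaban1983to89.B9BetaRangeKLevelV1
import Literature.MathematicalPhysics.QuantumFieldTheory.Balaban1983to89.B9PinMembersKLevelV1
import Literature.MathematicalPhysics.QuantumFieldTheory.Balaban1983to89.Node00.OpsYOfLetters

/-!
# Balaban [4] (2.1)–(2.3) p. 224 ∕ (2.45) p. 231, «sites replaced by bonds» p. 248 — def-Y's MEMBER TYPE CONTAINS A FAMILY WITH AN INNER CORNER: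
# the «notch» family (`Ω_{k−1}` = the `d+1` big blocks forward-adjacent to one big block) is a `MemberY` beyond every threshold and its carrier-block map `β`
# is NOT onto `𝔅` — hence NO family of sections `ιB : ∀ x : MemberY …, BlkY x → IBondY x` with `β (ιB x s) = s` exists
# (kernel certificate for LOCATED-19 of seat dag-n06-c g18: the (α4) face p731579 displays exactly that pair at `J := MemberY …`, `f := id`; pub-ymgap N06 ∕ N24)

T. Bałaban, *Propagators and renormalization transformations for lattice gauge theories. II*, Commun. Math. Phys. **96** (1984) 223–250 [`Balaban1984PropagatorsII`,
"[4]"], (2.1)–(2.4) p. 224 («Ω_j^{(j)} … is a sum of big blocks»; «We admit the case when some domains Ω_j are equal to T_η»; (2.3) «Λ_j also denotes the set of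
bonds …»), (2.45) p. 231 (`𝔅 = ⋃_j Λ_j`), p. 248 («… with sites replaced by bonds»); T. Bałaban, *Propagators for lattice gauge theories in a background field*,
Commun. Math. Phys. **99** (1985) 389–434 [`Balaban1985BackgroundPropagators`, "B9"], (3.48) p. 398, Thm 3.4 p. 400 (the block-indexed statements read at carrier blocks).

statement-level skeleton of published theorems with citation tags; proofs where landed; nothing here is a claim about the Yang–Mills mass gap

WHY THIS FILE (cell context).  The N06 certificate's (α3) block (dag-n06-c `B9SectBStepUGuardedR` §4b ∕ `B9SectBStepUClosedSUOfSections`) quantifies a sub-family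
`f : J → MemberY …` TOGETHER WITH sections `ιB j : BlkY (f j) → IBondY (f j)`, `hι : β (ιB j s) = s` — harmless there (it restricts the sub-family to
SECTION-CARRYING members).  The K1 face (α4) `…N24K1FaceTrN06UD…PrintedZBY` (p731579) instantiates `J := MemberY (stage3OfFamily F)… (Mstar F)`, `f := id`,
so its displayed pair `(ιB F) (hι F)` (l.253) asks a RIGHT INVERSE OF `β` AT EVERY MEMBER of the record — by dag-n06-i's `B9BetaRangeKLevelV1.surjective_beta_iff`
«no member has an inner corner».  THIS FILE settles the existence question the tree left open (`B9BetaRangeKLevelV1`: «whether a given member HAS an inner corner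
is not decided here»; the landed non-vacuity witnesses `exists_const_TDomains` ∕ `exists_twoTopBelow_TDomains` ∕ `MemberY.diag` are constant-level or single-box,
hence section-carrying): the NOTCH family — `Ω₁ = … = Ω_{k−2} = T_η`, `Ω_{k−1}` = the `d + 1` big `(k−1)`-blocks with labels `e_μ`, `Ω_k = ∅` — satisfies (2.1)
(membership read off the big-block label) and (2.2) (void for two adjacent levels, exactly as for the landed witnesses), is a `KIdx` ∕ `MemberY` at every odd
`L ≥ 5`, every `M⋆`, beyond every threshold (the V1 parameters of `B6KLevelFamilyWitnessOddLV1`), and the `(k−2)`-block at the MAXIMAL CORNER of the big block at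
the origin has every forward neighbour inside `Ω_{k−1}` and every backward neighbour in `Ω_{k−2} = T_η` — an inner corner, so `β` misses it
(`not_surjective_beta_of_corner`).  Consequence (ref-H g33 VERDICT 587 re-label, 2026-08-29): the (α4) face's hypothesis list is unsatisfiable as instantiated;
the agreed cure (α5) re-keys the face at the section-carrying sub-family `{x : MemberY … // Function.Surjective (β …)}` (two displayed binders fewer).

WHAT IS PROVED (sorry-free; standard axioms; 1 `def`: the level function `notchLev`).
* §1 `notchLev`, `notchLev_eq_or`, `le_notchLev_iff`, ★ `exists_notch_TDomains` (the notch family on every torus, `k ≥ 3`).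
* §2 `not_exists_sections_of_not_surjective` (logic: one non-surjective member forbids a family of sections).
* §3 ★ `exists_kIdx_notch` (a `KIdx` in print's units `c_f = Lᵏ` with the notch family, `M_h = Lᵃ` beyond any `M₁`, `P′ ≡ 2L²`), ★ `exists_memberY_notch`
  (the diagonal `MemberY` over it, any `M⋆`).
* §4 ★★★ `not_surjective_beta_of_notch` — for ANY torus identification `hN`, any family `D` with `D.lev = notchLev ℓ k M_h` (`k ≥ 3`, `M_h ≥ 1`, `P′_μ ≥ 2`):
  `¬ Function.Surjective (β hN D hk)` (the corner site `(b−1, …, b−1)`, `b = bigSide (k−1)`; its neighbours `± L^{k−2} e_μ`; labels computed exactly, no wrap-around).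
* §5 ★★★ `exists_member_not_surjective_beta` (`∀ M⋆ M₁, ∃ x : MemberY …, M₁ ≤ M ∧ ¬ Surjective β_x`), ★★★ `not_exists_sections_memberY`
  (`¬ ∃ ιB : ∀ x : MemberY … M⋆, BlkY x → IBondY x, ∀ x s, β (ιB x s) = s` — the (α4) display shape, every `M⋆`).

HONEST SCOPE.  Lattice combinatorics of the tree's own index sets ([4]'s domains and index bonds on the cell's V1 torus chart); nothing of [B9]'s or [4]'s
analysis is asserted or denied; the located statement concerns ONE INSTANTIATION CHOICE (`f := id`) of a face, not the N06 certificate (whose (α3) block keeps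
`f` generic) and not FLAG №8's closure; COUNT-NEUTRAL; N06 ∕ N24 NOT discharged, NOT refuted; one finite lattice programme — nothing continuum, nothing about the
mass gap.  Cell `pub-ymgap` (HUMAN RULING D-0062), Track A nodes N06 [B9] ∕ N24, seat `pub-ymgap-dag-n06-c` g18, 2026-08-29.  NEW file; nothing landed is modified.
Net new unproved facts: 0.
-/

noncomputable section

namespace Literature.MathematicalPhysics.QuantumFieldTheory.Balaban1983to89.B9BetaNotchMemberV1

open B4Reflection242 (boxDom mem_boxDom blk blk_mul)
open B4TorusKernel.MultiPeriod (torusSupNorm)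
open B6MultiLevelBoxOperator (Domains N0 bigSide one_le_bigSide bigSide_eq)
open B6MultiLevelTorusOperator (TDomains N0_eq_bigSide_mul)
open B6GlobalChartV1 (PV domT toBox toBox_apply blk_toBox iterBlockOf_mem_domT_iff blk_bigSide_eq_of_blk_eq)
open B6SectAOperatorsV1 (BondIdx)
open B6CubeWindowV1 (Placed GlobalBand placed_of_lt)
open B6Cover236MultiLevelBlocks (cubes)
open B6KLevelFamilyWitnessV1 (N0_V1_pow globalBand_witness exists_exponent)
open B6KLevelFamilyWitnessOddLV1 (placed_of_lev_le)
open B6KLevelCensusIndexV1 (KIdx kGeoG)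
open B6Ineq2142KLevelV1 (β)
open B9BetaRangeKLevelV1 (not_surjective_beta_of_corner)
open B9PinMembersKLevelV1 (MemberY geo9Y)
open B5Eq118OneStroke (iterBlockOf iterBlockOf_succ val_iterBlockOf)
open LatticeFieldCalculus

variable {d : ℕ}

/-! ## §1 The notch level function -/

open Classical in
/-- **THE NOTCH LEVEL FUNCTION** at nominal index `k` (`k ≥ 3`): level `k − 1` on the `d + 1` big `(k−1)`-blocks with labels `e_μ` (the blocks forward-adjacent to
the big block at the origin), level `k − 2` elsewhere — `Ω₁ = … = Ω_{k−2} = T_η`, `Ω_{k−1}` = the notch, `Ω_k = ∅`.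
[cite: Balaban1984PropagatorsII, (2.1) p.224 («Ω_j^{(j)} … is a sum of big blocks»; «We admit the case when some domains Ω_j are equal to T_η»)] -/
def notchLev (ℓ k Mh : ℕ) (x : Fin (d + 1) → ℤ) : ℕ :=
  if ∃ μ : Fin (d + 1), blk (bigSide ℓ Mh (k - 1)) x = Pi.single μ 1 then k - 1 else k - 2

/-- the notch level function takes the values `k − 1`, `k − 2` only. [cite: Balaban1984PropagatorsII, (2.1) p.224, bookkeeping] -/
theorem notchLev_eq_or (ℓ k Mh : ℕ) (x : Fin (d + 1) → ℤ) : notchLev (d := d) ℓ k Mh x = k - 1 ∨ notchLev (d := d) ℓ k Mh x = k - 2 := by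
  unfold notchLev; split_ifs
  · exact Or.inl rfl
  · exact Or.inr rfl

/-- the level-`(k−1)` set of the notch function IS the notch: `k − 1 ≤ notchLev x ↔ ∃ μ, blk (bigSide (k−1)) x = e_μ` (`k ≥ 3`).
[cite: Balaban1984PropagatorsII, (2.1) p.224, bookkeeping] -/
theorem le_notchLev_iff {ℓ k Mh : ℕ} (hk : 3 ≤ k) (x : Fin (d + 1) → ℤ) :
    k - 1 ≤ notchLev (d := d) ℓ k Mh x ↔ ∃ μ : Fin (d + 1), blk (bigSide ℓ Mh (k - 1)) x = Pi.single μ 1 := by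
  classical
  unfold notchLev; split_ifs with h
  · exact ⟨fun _ => h, fun _ => le_rfl⟩
  · simp only [h, iff_false, not_le]; omega

/-- **THE NOTCH FAMILY ON EVERY TORUS** (`k ≥ 3`): a nested torus family of (2.1)–(2.2) with level function `notchLev` — (2.1) because membership in the
notch is read off the big `(k−1)`-block label, (2.2) void (two adjacent inhabited levels only, exactly as for the landed top-empty witnesses).
[cite: Balaban1984PropagatorsII, (2.1)–(2.2) p.224] -/
theorem exists_notch_TDomains (d ℓ Mh k : ℕ) (P : Fin (d + 1) → ℕ) (R : ℕ) (hk : 3 ≤ k) :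
    ∃ D : TDomains d ℓ Mh k P R, D.lev = notchLev ℓ k Mh := by
  refine ⟨{ lev := notchLev ℓ k Mh
            one_le_lev := fun x => by rcases notchLev_eq_or (d := d) ℓ k Mh x with h | h <;> omega
            lev_le := fun x => by rcases notchLev_eq_or (d := d) ℓ k Mh x with h | h <;> omega
            bigBlocks := ?_
            sepT := ?_ }, rfl⟩
  · intro j _ x _ x' _ hb
    by_cases hjk : j ≤ k - 2
    · constructor <;> intro _
      · rcases notchLev_eq_or (d := d) ℓ k Mh x' with h | h <;> omega
      · rcases notchLev_eq_or (d := d) ℓ k Mh x with h | h <;> omega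
    by_cases hje : j = k - 1
    · subst hje
      rw [le_notchLev_iff hk, le_notchLev_iff hk, hb]
    · constructor <;> intro h
      · rcases notchLev_eq_or (d := d) ℓ k Mh x with e | e <;> omega
      · rcases notchLev_eq_or (d := d) ℓ k Mh x' with e | e <;> omega
  · intro j x _ x' _ h1 h2
    exfalso
    rcases notchLev_eq_or (d := d) ℓ k Mh x with e | e <;> rcases notchLev_eq_or (d := d) ℓ k Mh x' with e' | e' <;>
      simp only [e, e'] at h1 h2 <;> omega

/-! ## §2 Sections of `β` over a family: one non-surjective member forbids them (logic) -/

/-- **NO GLOBAL SECTIONS PAST A NON-SURJECTIVE MEMBER**: if one member's carrier-block map is not onto, there is no family of sections over ALL members.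
[cite: Balaban1984PropagatorsII, (2.3) p.224 + (2.45) p.231, bookkeeping] -/
theorem not_exists_sections_of_not_surjective {J : Type} {B I : J → Type} (βf : ∀ j, I j → B j) (j₀ : J) (h : ¬ Function.Surjective (βf j₀)) :
    ¬ ∃ ι : ∀ j, B j → I j, ∀ j s, βf j (ι j s) = s :=
  fun ⟨ι, hι⟩ => h fun s => ⟨ι j₀ s, hι j₀ s⟩

/-! ## §3 The notch family as a member of the k-level census index and of def-Y's `MemberY`, beyond every threshold -/

/-- **THE NOTCH FAMILY IS A MEMBER OF THE k-LEVEL INDEX `KIdx` AT EVERY ODD `L ≥ 5`, IN PRINT's UNITS, BEYOND EVERY `M`-THRESHOLD** (`k ≥ 3`): the V1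
parameters of the landed top-empty witness (`B6KLevelFamilyWitnessOddLV1.kLevelFamily_nonvacuous_oddL`: `m = k + a + 3`, `K = 0`, `M_h = Lᵃ ≥ 8`,
`R = P′_μ = 2L²`, every cube `Placed` because the top level is empty, band-(2.16) weights) with the torus family replaced by the notch family of §1.
[cite: Balaban1984PropagatorsII, (2.1)–(2.4) p.224, (2.16) p.225, Prop. 2.2 p.234 («M is sufficiently large»)] -/
theorem exists_kIdx_notch (d ℓ k : ℕ) (hd : 1 ≤ d + 1) (hL : Odd (ℓ + 1) ∧ 1 < ℓ + 1) (hℓ : 4 ≤ ℓ) (hk : 3 ≤ k)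
    (M₁ : ℝ) {b₀ b₁ : ℝ} (hb₀ : 0 < b₀) (hb₁ : b₀ ≤ b₁) :
    ∃ i : KIdx d ℓ hd hL b₀ b₁, i.k = k ∧ i.cf = (((ℓ + 1 : ℕ) : ℝ)) ^ i.k ∧ M₁ ≤ ((ℓ : ℝ) + 1) * i.Mh ∧ 1 ≤ i.Mh ∧
      (∀ μ, i.P' μ = 2 * (ℓ + 1) ^ 2) ∧ i.D.lev = notchLev ℓ k i.Mh := by
  obtain ⟨a, h8, hM₂, -⟩ := exists_exponent ℓ (by omega) M₁ 0 (2 * (ℓ + 1) ^ 2) (by nlinarith)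
  have hMh : 1 ≤ (ℓ + 1) ^ a := Nat.one_le_pow _ _ (Nat.succ_pos ℓ)
  set P' : Fin (d + 1) → ℕ := fun _ => 2 * (ℓ + 1) ^ 2 with hP'
  have hP5 : ∀ μ : Fin (d + 1), 5 ≤ P' μ := fun μ => by simp only [hP']; nlinarith
  have hN : ∀ μ, N0 ℓ ((ℓ + 1) ^ a) k P' μ = (PV d ℓ (k + a + 3) 0 hd hL).sitesPerDir 0 :=
    fun μ => N0_V1_pow ℓ k a 2 (k + a + 3) 0 hd hL (by ring) μ
  have hk' : k ≤ k + a + 3 + 0 := by omega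
  obtain ⟨D, hD⟩ := exists_notch_TDomains d ℓ ((ℓ + 1) ^ a) k P' (2 * (ℓ + 1) ^ 2) hk
  have htop : ∀ x, D.lev x ≤ k - 1 := fun x => by
    rw [hD]; rcases notchLev_eq_or (d := d) ℓ k ((ℓ + 1) ^ a) x with h | h <;> omega
  obtain ⟨w, hw, hwb⟩ := globalBand_witness (domT hN D hk') hb₀ hb₁
  set cf : ℝ := (((ℓ + 1 : ℕ) : ℝ)) ^ k with hcfdef
  have hcf : cf ≠ 0 := by positivity
  have hwb' : GlobalBand b₀ b₁ cf (fun i => cf ^ 2 * w i) := by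
    intro i
    obtain ⟨h1, h2⟩ := hwb i
    have key : cf ^ 2 * w i / (cf / (((ℓ + 1 : ℕ) : ℝ)) ^ (i.1.1 : ℕ)) ^ 2 = w i / (1 / (((ℓ + 1 : ℕ) : ℝ)) ^ (i.1.1 : ℕ)) ^ 2 := by
      field_simp
    rw [key]
    exact ⟨h1, h2⟩
  refine ⟨⟨k + a + 3, 0, (ℓ + 1) ^ a, k, 2 * (ℓ + 1) ^ 2, a, P', hN, D, hk', by omega, rfl, h8, le_rfl, hP5, hℓ,
    placed_of_lev_le D.toDomains hP5 (j := k - 1) (by omega) htop, cf, hcf, fun i => cf ^ 2 * w i,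
    fun i => mul_pos (by positivity) (hw i), hwb'⟩, rfl, rfl, ?_, hMh, fun _ => rfl, hD⟩
  show M₁ ≤ ((ℓ : ℝ) + 1) * ((((ℓ + 1) ^ a : ℕ)) : ℝ)
  exact hM₂

/-- **… HENCE A MEMBER OF def-Y's `MemberY d ℓ … M⋆`** (the diagonal member over the notch index; `M⋆ ≤ M`, any real threshold `M₁ ≤ M`).
[cite: Balaban1984PropagatorsII, (2.1)–(2.4) p.224; Balaban1985BackgroundPropagators, Thm 3.14 pp.426–427 (the two sequences — here equal)] -/
theorem exists_memberY_notch (d ℓ k : ℕ) (hd : 1 ≤ d + 1) (hL : Odd (ℓ + 1) ∧ 1 < ℓ + 1) (hℓ : 4 ≤ ℓ) (hk : 3 ≤ k)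
    (Mstar : ℕ) (M₁ : ℝ) {b₀ b₁ : ℝ} (hb₀ : 0 < b₀) (hb₁ : b₀ ≤ b₁) :
    ∃ x : MemberY d ℓ hd hL b₀ b₁ Mstar, x.k = k ∧ M₁ ≤ (geo9Y x).M ∧ 1 ≤ x.Mh ∧ (∀ μ, x.P' μ = 2 * (ℓ + 1) ^ 2) ∧
      x.D.lev = notchLev ℓ k x.Mh := by
  obtain ⟨i, hik, hcf, hM, hMh, hP, hD⟩ := exists_kIdx_notch d ℓ k hd hL hℓ hk (max M₁ (Mstar : ℝ)) hb₀ hb₁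
  have hMstar : Mstar ≤ (ℓ + 1) * i.Mh := by
    have h : (Mstar : ℝ) ≤ ((ℓ : ℝ) + 1) * (i.Mh : ℝ) := le_trans (le_max_right _ _) hM
    have h' : ((Mstar : ℕ) : ℝ) ≤ (((ℓ + 1) * i.Mh : ℕ) : ℝ) := by push_cast; linarith
    exact_mod_cast h'
  refine ⟨MemberY.diag i hcf hMstar, hik, ?_, hMh, hP, hD⟩
  show M₁ ≤ (((ℓ + 1 : ℕ) : ℝ)) * (i.Mh : ℝ)
  have hcast : (((ℓ + 1 : ℕ) : ℝ)) = (ℓ : ℝ) + 1 := by push_cast; ring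
  rw [hcast]; exact le_trans (le_max_left _ _) hM

/-! ## §4 The inner corner of the notch family: `β` is not onto `𝔅` -/

section Arith

/-- `(Mq − 1)/q = M − 1` (`M, q ≥ 1`). [folklore] -/
private theorem div_pred_mul {M q : ℕ} (hM : 1 ≤ M) (hq : 1 ≤ q) : (M * q - 1) / q = M - 1 := by
  obtain ⟨M', rfl⟩ : ∃ M', M = M' + 1 := ⟨M - 1, by omega⟩
  have e1 : (M' + 1) * q = M' * q + q := by ring
  rw [Nat.add_sub_cancel]
  apply Nat.div_eq_of_lt_le <;> rw [e1]
  · omega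
  · have e2 : (M' + 1) * q = M' * q + q := by ring
    omega

/-- `(Mq − 1 + q)/q = M` (`M, q ≥ 1`). [folklore] -/
private theorem div_pred_mul_add {M q : ℕ} (hM : 1 ≤ M) (hq : 1 ≤ q) : (M * q - 1 + q) / q = M := by
  have hMq : 1 ≤ M * q := Nat.mul_pos hM hq
  have e2 : (M + 1) * q = M * q + q := by ring
  apply Nat.div_eq_of_lt_le
  · omega
  · rw [e2]; omega

/-- `(Mq − 1 − q)/q = M − 2` (`M ≥ 2`, `q ≥ 1`). [folklore] -/
private theorem div_pred_mul_sub {M q : ℕ} (hM : 2 ≤ M) (hq : 1 ≤ q) : (M * q - 1 - q) / q = M - 2 := by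
  obtain ⟨M', rfl⟩ : ∃ M', M = M' + 2 := ⟨M - 2, by omega⟩
  have e1 : (M' + 2) * q = M' * q + q + q := by ring
  have e2 : (M' + 1) * q = M' * q + q := by ring
  rw [Nat.add_sub_cancel]
  apply Nat.div_eq_of_lt_le
  · rw [e1]; omega
  · rw [e2, e1]; omega

end Arith

section Corner

variable {ℓ m K : ℕ} {hd : 1 ≤ d + 1} {hL : Odd (ℓ + 1) ∧ 1 < ℓ + 1} {Mh k R : ℕ} {P' : Fin (d + 1) → ℕ}
  (hN : ∀ μ, N0 ℓ Mh k P' μ = (PV d ℓ m K hd hL).sitesPerDir 0) (D : TDomains d ℓ Mh k P' R) (hk : k ≤ m + K)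

/-- a fine site with prescribed labels `t_ν < N`. [cite: Balaban1984PropagatorsII, (2.1) p.224, dictionary] -/
private def siteOfNat (t : Fin (d + 1) → ℕ) : Site (PV d ℓ m K hd hL) 0 := fun ν => ((t ν : ℕ) : ZMod ((PV d ℓ m K hd hL).sitesPerDir 0))

/-- its labels ARE `t` (no reduction). [cite: Balaban1984PropagatorsII, (2.1) p.224, dictionary] -/
private theorem val_siteOfNat (t : Fin (d + 1) → ℕ) (ht : ∀ ν, t ν < (PV d ℓ m K hd hL).sitesPerDir 0) (ν : Fin (d + 1)) :
    ((siteOfNat (ℓ := ℓ) (m := m) (K := K) (hd := hd) (hL := hL) t) ν).val = t ν := by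
  simp only [siteOfNat, ZMod.val_natCast, Nat.mod_eq_of_lt (ht ν)]

/-- `y + e_μ = y′` from the labels: `val y′_μ = val y_μ + 1`, other labels equal. [folklore] -/
private theorem shift_eq_of_val {j : ℕ} (y y' : Site (PV d ℓ m K hd hL) j) (μ : Fin (d + 1))
    (hμ : (y' μ).val = (y μ).val + 1) (hν : ∀ ν, ν ≠ μ → (y' ν).val = (y ν).val) : y.shift μ = y' := by
  funext ν
  by_cases h : ν = μ
  · subst h
    simp only [Site.shift, Function.update_self]
    rw [← ZMod.natCast_zmod_val (y' ν), hμ, Nat.cast_add, Nat.cast_one, ZMod.natCast_zmod_val]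
  · simp only [Site.shift, Function.update_of_ne h]
    exact ZMod.val_injective _ (hν ν h).symm

/-- `y − e_μ = y′` from the labels: `val y_μ = val y′_μ + 1`, other labels equal. [folklore] -/
private theorem unshift_eq_of_val {j : ℕ} (y y' : Site (PV d ℓ m K hd hL) j) (μ : Fin (d + 1))
    (hμ : (y μ).val = (y' μ).val + 1) (hν : ∀ ν, ν ≠ μ → (y' ν).val = (y ν).val) : y.unshift μ = y' := by
  funext ν
  by_cases h : ν = μ
  · subst h
    simp only [Site.unshift, Function.update_self]
    rw [← ZMod.natCast_zmod_val (y ν), hμ, Nat.cast_add, Nat.cast_one, ZMod.natCast_zmod_val, add_sub_cancel_right]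
  · simp only [Site.unshift, Function.update_of_ne h]
    exact ZMod.val_injective _ (hν ν h).symm

/-- the big `(k−1)`-block label of a fine site, coordinatewise, as a natural-number quotient of its label.
[cite: Balaban1984PropagatorsII, (2.1) p.224, dictionary] -/
private theorem blk_toBox_apply (b : ℕ) (x : Site (PV d ℓ m K hd hL) 0) (ν : Fin (d + 1)) :
    blk b (toBox hN x : Fin (d + 1) → ℤ) ν = (((x ν).val / b : ℕ) : ℤ) := by
  simp only [blk, toBox_apply, Int.natCast_div]

/-- ★★★ **THE NOTCH FAMILY HAS AN INNER CORNER, SO ITS CARRIER-BLOCK MAP `β` IS NOT ONTO `𝔅`** (`k ≥ 3`, `M_h ≥ 1`, `P′_μ ≥ 2`): the `(k−2)`-block at the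
maximal corner of the big `(k−1)`-block at the origin has EVERY forward neighbour inside the notch `Ω_{k−1}` (deep) and every backward neighbour in
`Ω_{k−2} = T_η`, hence (dag-n06-i's `B9BetaRangeKLevelV1.not_surjective_beta_of_corner`) it is the carrier block of NO index bond.
[cite: Balaban1984PropagatorsII, (2.3) p.224 + (2.45) p.231; p.248 («sites replaced by bonds»)] -/
theorem not_surjective_beta_of_notch (hk3 : 3 ≤ k) (hMh : 1 ≤ Mh) (hP2 : ∀ μ, 2 ≤ P' μ) (hlev : D.lev = notchLev ℓ k Mh) :
    ¬ Function.Surjective (β hN D hk) := by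
  -- sizes: `q = L^{k−2}` fine steps per `(k−2)`-block, `M = M_h L²` such blocks per big `(k−1)`-block side, `b = bigSide (k−1) = M q`
  set q : ℕ := (ℓ + 1) ^ (k - 2) with hqdef
  set M : ℕ := Mh * (ℓ + 1) ^ 2 with hMdef
  set b : ℕ := bigSide ℓ Mh (k - 1) with hbdef
  have hq1 : 1 ≤ q := Nat.one_le_pow _ _ (Nat.succ_pos ℓ)
  have hM2 : 2 ≤ M := by
    have : 1 ≤ (ℓ + 1) ^ 2 := Nat.one_le_pow _ _ (Nat.succ_pos ℓ)
    have h4 : 4 ≤ (ℓ + 1) ^ 2 := by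
      obtain ⟨_, h1⟩ := hL; nlinarith
    calc 2 ≤ 1 * 4 := by norm_num
      _ ≤ Mh * (ℓ + 1) ^ 2 := Nat.mul_le_mul hMh h4
  have hM1 : 1 ≤ M := by omega
  have hbMq : b = M * q := by
    rw [hbdef, bigSide, hMdef, hqdef, mul_assoc, ← pow_add]
    congr 2; omega
  have hb1 : 1 ≤ b := by rw [hbMq]; exact Nat.mul_pos hM1 hq1
  have hqb : q ≤ b := by rw [hbMq]; exact Nat.le_mul_of_pos_left q hM1
  -- the torus period: `N = L·b·P′_μ ≥ 2·L·b`
  have hN' : ∀ μ, (PV d ℓ m K hd hL).sitesPerDir 0 = (ℓ + 1) * b * P' μ := fun μ => by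
    rw [← hN μ, N0_eq_bigSide_mul, hbdef, bigSide, bigSide, show k - 1 + 1 = k by omega, pow_succ]; ring
  have hroom : ∀ μ, b - 1 + q < (PV d ℓ m K hd hL).sitesPerDir 0 := fun μ => by
    rw [hN' μ]
    have h2 : (ℓ + 1) * b * 2 ≤ (ℓ + 1) * b * P' μ := Nat.mul_le_mul_left _ (hP2 μ)
    have hℓ1 : 1 ≤ ℓ + 1 := Nat.succ_pos ℓ
    calc b - 1 + q < 1 * b * 2 := by omega
      _ ≤ (ℓ + 1) * b * 2 := Nat.mul_le_mul_right _ (Nat.mul_le_mul_right _ hℓ1)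
      _ ≤ (ℓ + 1) * b * P' μ := h2
  have hkmK : k - 2 ≤ m + K := by omega
  have hkmK1 : k - 2 + 1 ≤ m + K := by omega
  -- the corner site `x₀ = (b − 1, …, b − 1)` and its two kinds of neighbours at distance `q`
  let x₀ : Site (PV d ℓ m K hd hL) 0 := siteOfNat fun _ => b - 1
  have hx₀ : ∀ ν, (x₀ ν).val = b - 1 := fun ν => val_siteOfNat _ (fun ν => by have := hroom ν; omega) ν
  -- its level is `k − 2`: the big-block label of `x₀` is `0`
  have hblk₀ : blk b (toBox hN x₀ : Fin (d + 1) → ℤ) = 0 := by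
    funext ν; rw [blk_toBox_apply hN b x₀ ν, hx₀, Nat.div_eq_of_lt (Nat.sub_lt hb1 Nat.one_pos)]; rfl
  have hlev₀ : D.lev (toBox hN x₀ : Fin (d + 1) → ℤ) = k - 2 := by
    rw [hlev]; unfold notchLev
    rw [if_neg]
    rintro ⟨μ, hμ⟩
    rw [← hbdef, hblk₀] at hμ
    have := congrFun hμ μ
    simp at this
  refine not_surjective_beta_of_corner hN D hk (by omega) x₀ ?_ ?_
  · -- forward neighbours are deep: the `(k−1)`-block of `x₁ = x₀ + q e_μ` lies in the notch block `e_μ`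
    intro μ
    rw [hlev₀]
    let x₁ : Site (PV d ℓ m K hd hL) 0 := siteOfNat fun ν => if ν = μ then b - 1 + q else b - 1
    have hx₁ : ∀ ν, (x₁ ν).val = if ν = μ then b - 1 + q else b - 1 := fun ν =>
      val_siteOfNat _ (fun ν => by by_cases h : ν = μ <;> simp only [h, if_true, if_false] <;> [exact hroom ν; (have := hroom ν; omega)]) ν
    -- `y₀ + e_μ = y^{k−2}(x₁)`
    have hsh : (iterBlockOf (k - 2) x₀).shift μ = iterBlockOf (k - 2) x₁ := by
      apply shift_eq_of_val
      · rw [val_iterBlockOf (k - 2) hkmK x₁ μ, val_iterBlockOf (k - 2) hkmK x₀ μ, hx₁, hx₀, if_pos rfl]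
        show (b - 1 + q) / q = (b - 1) / q + 1
        rw [hbMq, div_pred_mul_add hM1 hq1, div_pred_mul hM1 hq1]; omega
      · intro ν hν
        rw [val_iterBlockOf (k - 2) hkmK x₁ ν, val_iterBlockOf (k - 2) hkmK x₀ ν, hx₁, hx₀, if_neg hν]
    show blockOf ((iterBlockOf (k - 2) x₀).shift μ) ∈ (domT hN D hk).Om (k - 2 + 1)
    rw [hsh, ← iterBlockOf_succ, iterBlockOf_mem_domT_iff hN D hk (by omega) (by omega) x₁, hlev, show k - 2 + 1 = k - 1 by omega,
      le_notchLev_iff hk3]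
    refine ⟨μ, funext fun ν => ?_⟩
    rw [← hbdef, blk_toBox_apply hN b x₁ ν, hx₁, Pi.single_apply]
    by_cases hν : ν = μ
    · rw [if_pos hν, if_pos hν]
      have : (b - 1 + q) / b = 1 := Nat.div_eq_of_lt_le (by omega) (by omega)
      rw [this]; rfl
    · rw [if_neg hν, if_neg hν, Nat.div_eq_of_lt (Nat.sub_lt hb1 Nat.one_pos)]; rfl
  · -- backward neighbours lie in `Ω_{k−2} = T_η`: `y₀ − e_μ = y^{k−2}(x₂)`, `x₂ = x₀ − q e_μ`, and every site has level `≥ k − 2`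
    intro μ
    rw [hlev₀]
    let x₂ : Site (PV d ℓ m K hd hL) 0 := siteOfNat fun ν => if ν = μ then b - 1 - q else b - 1
    have hx₂ : ∀ ν, (x₂ ν).val = if ν = μ then b - 1 - q else b - 1 := fun ν =>
      val_siteOfNat _ (fun ν => by by_cases h : ν = μ <;> simp only [h, if_true, if_false] <;> (have := hroom ν; omega)) ν
    have hush : (iterBlockOf (k - 2) x₀).unshift μ = iterBlockOf (k - 2) x₂ := by
      apply unshift_eq_of_val
      · rw [val_iterBlockOf (k - 2) hkmK x₂ μ, val_iterBlockOf (k - 2) hkmK x₀ μ, hx₂, hx₀, if_pos rfl]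
        show (b - 1) / q = (b - 1 - q) / q + 1
        rw [hbMq, div_pred_mul hM1 hq1, div_pred_mul_sub hM2 hq1]; omega
      · intro ν hν
        rw [val_iterBlockOf (k - 2) hkmK x₂ ν, val_iterBlockOf (k - 2) hkmK x₀ ν, hx₂, hx₀, if_neg hν]
    rw [hush, iterBlockOf_mem_domT_iff hN D hk (by omega) (by omega) x₂, hlev]
    rcases notchLev_eq_or (d := d) ℓ k Mh (toBox hN x₂ : Fin (d + 1) → ℤ) with h | h <;> omega

end Corner

/-! ## §5 ★★★ The certificate: `MemberY` contains a member with non-surjective `β`; no family of sections over all members exists -/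

section Certificate

variable {d' : ℕ}

/-- ★★★ **def-Y's MEMBER TYPE CONTAINS, BEYOND EVERY THRESHOLD, A MEMBER WHOSE CARRIER-BLOCK MAP `β` IS NOT ONTO `𝔅`** (odd `L ≥ 5`, every `d`, every
`M⋆`, every real threshold `M₁ ≤ M`, `0 < b₀ ≤ b₁`): the notch member of §3 (nominal index `k = 3`).
[cite: Balaban1984PropagatorsII, (2.1)–(2.4) p.224, (2.45) p.231; p.248 («sites replaced by bonds»)] -/
theorem exists_member_not_surjective_beta (d ℓ : ℕ) (hd : 1 ≤ d + 1) (hL : Odd (ℓ + 1) ∧ 1 < ℓ + 1) (hℓ : 4 ≤ ℓ)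
    (Mstar : ℕ) (M₁ : ℝ) {b₀ b₁ : ℝ} (hb₀ : 0 < b₀) (hb₁ : b₀ ≤ b₁) :
    ∃ x : MemberY d ℓ hd hL b₀ b₁ Mstar, M₁ ≤ (geo9Y x).M ∧ ¬ Function.Surjective (β x.toKIdx.hN x.toKIdx.D x.toKIdx.hk) := by
  obtain ⟨x, hk, hM, hMh, hP, hD⟩ := exists_memberY_notch d ℓ 3 hd hL hℓ le_rfl Mstar M₁ hb₀ hb₁
  refine ⟨x, hM, ?_⟩
  have hk3 : 3 ≤ x.toKIdx.k := by rw [show x.toKIdx.k = x.k from rfl, hk]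
  exact not_surjective_beta_of_notch x.toKIdx.hN x.toKIdx.D x.toKIdx.hk hk3 hMh
    (fun μ => by rw [show x.toKIdx.P' μ = x.P' μ from rfl, hP μ]; nlinarith) (by rw [hD, hk])

/-- ★★★ **HENCE NO FAMILY OF SECTIONS OF `β` OVER ALL MEMBERS EXISTS** — the displayed pair `(ιB : ∀ x : MemberY …, BlkY x → IBondY x) (hι : ∀ x s, β (ιB x s) = s)`
of a face instantiated at the WHOLE member type (`J := MemberY …`, `f := id`) is UNSATISFIABLE, for every `M⋆` (odd `L ≥ 5`, `0 < b₀ ≤ b₁`).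
[cite: Balaban1984PropagatorsII, (2.3) p.224 + (2.45) p.231; p.248] -/
theorem not_exists_sections_memberY (d ℓ : ℕ) (hd : 1 ≤ d + 1) (hL : Odd (ℓ + 1) ∧ 1 < ℓ + 1) (hℓ : 4 ≤ ℓ)
    (Mstar : ℕ) {b₀ b₁ : ℝ} (hb₀ : 0 < b₀) (hb₁ : b₀ ≤ b₁) :
    ¬ ∃ ιB : ∀ x : MemberY d ℓ hd hL b₀ b₁ Mstar, Node00.BlkY x.toKIdx → Node00.IBondY x.toKIdx,
        ∀ (x : MemberY d ℓ hd hL b₀ b₁ Mstar) (s : Node00.BlkY x.toKIdx), β x.toKIdx.hN x.toKIdx.D x.toKIdx.hk (ιB x s) = s := by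
  obtain ⟨x₀, -, hx₀⟩ := exists_member_not_surjective_beta d ℓ hd hL hℓ Mstar 0 hb₀ hb₁
  exact not_exists_sections_of_not_surjective (fun x : MemberY d ℓ hd hL b₀ b₁ Mstar => β x.toKIdx.hN x.toKIdx.D x.toKIdx.hk) x₀ hx₀

end Certificate

end Literature.MathematicalPhysics.QuantumFieldTheory.Balaban1983to89.B9BetaNotchMemberV1

end
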